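import Summits.CriticalPhenomena.CardyFormulaZ2.Theses.CardyPerronTeleport
import Literature.Probability.Percolation.CardyFormulaConformalInvariance

/-!
# Birth skeleton (BC3) for the crux `HalfStripCardyZ2` — stmt-CriticalPhenomena-5178

Route `CardyPerronTeleport` (route-CriticalPhenomena-CardyPerronTeleport), sub-problem
`CardyFormulaZ2`; crux (rank 0, ex-target, auto-crux):

  `HalfStripCardyZ2` — Cardy's formula on half-strip ENDS for bond percolation on `ℤ²` at `p = 1/2`:
  for fractions `0 ≤ ξ₀ < ξ₁ < ξ₂ < ξ₃ ≤ 1`, the `P_{1/2}`-probability that the bottom arcs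
  `[⌊ξ₀N⌋, ⌊ξ₁N⌋] × {0}` and `[⌊ξ₂N⌋, ⌊ξ₃N⌋] × {0}` of the discrete half-strip `{0,…,N} × ℕ` are
  joined by an open path of the half-strip tends, as `N → ∞`, to `F(η(ξ))`, `F = cardyFunction`,
  `η(ξ) = crossRatio (−cos πξᵢ)` (`w = −cos πz` uniformises the half-strip `{0 < Re z < 1, Im z > 0}`).

## The line (the route's own plan for its target, with the Smirnov side cut into two typed pieces)

Write `T_N(ξ)` for the site-`𝕋` (`p = 1/2`, `triGraph`, free walls) probability that the same two
bottom arcs are joined by open sites inside the `𝕋` half-strip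
`H_N = {0 ≤ Re ≤ N, Im ≥ 0} = {v | 0 ≤ v₁, 0 ≤ 2v₀ + v₁ ≤ 2N}` (equilateral embedding
`triEmbed v = v₀ + v₁ e^{iπ/3}`), `Z_N(ξ)` for the bond-`ℤ²` probability of the crux, and, for
`ρ ≥ 2`, `T^ρ_N(ξ)` for the site-`𝕋` probability that the arcs are joined inside the TRUNCATED
half-strip `D_{ρ,N} = {v ∈ H_N : |cos(π · triEmbed v / N)| < ρ}` — the lattice points of `N · D_ρ`,
`D_ρ = {z : 0 < Re z < 1, Im z > 0, |cos πz| < ρ}`, a bounded Jordan domain (the preimage of the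
half-disc `{|w| < ρ, Im w > 0}` under `w = −cos πz`) carrying the four marks `ξᵢ` on its bottom side.

* `stub_halfStripUniversality` (OPEN — the research content; the route's rank-2 crux
  `HalfStripUniversality`, stmt-CriticalPhenomena-5179, BY NAME): `Z_N(ξ) − T_N(ξ) → 0`.
  Intended mechanism (route header): the exact Izergin–Korepin / dilute-TL anchor PerronTeleport
  (stmt-6073, informal) + corner-fugacity irrelevance on `ℤ²`'s cell grid.
* `stub_truncatedCardyT` (Smirnov's theorem transferred to the explicit truncated lattice domains;
  size L): for every admissible `ξ`, every `ρ ≥ 2` and every `ε > 0` there is `N₀` with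
  `|T^ρ_N(ξ) − F(crossRatio (u^ρ(ξ)))| < ε` for all `N ≥ N₀` (i.e. `T^ρ_N(ξ) → F(crossRatio u^ρ(ξ))`,
  stated in `ε`–`N₀` form), where `u^ρᵢ = xᵢ / (1 + (xᵢ/ρ)²)`, `xᵢ = −cos πξᵢ`, are the boundary
  values of the marks under the uniformiser `Φ_ρ(z) = w / (1 + (w/ρ)²)`, `w = −cos πz`, of `D_ρ` onto
  `ℍ` (`s ↦ s/(1+s²) = 1/(s + 1/s)` maps the unit upper half-disc onto `ℍ`; `Φ_ρ = ρ · (that map) ∘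
  (w/ρ)`). Source of truth: Smirnov 2001 Thm 1 for every bounded Jordan conformal rectangle, PROVED
  in the tree as `Literature.Probability.Percolation.hasCrossingLimit_triDomainCrossingProb_holds`
  (so it is not carried as a hypothesis). Content: an explicit `ConformalRectangle` structure on
  `D_ρ` with this uniformizing datum, and the G02-discretisation of `triDomainCrossingProb` versus
  the explicit lattice sets `D_{ρ,N}` / arcs on row `0` (they differ by `O(1)` lattice spacings at
  the four marks: `o(1)` by RSW boundary estimates).
* `stub_truncationRSW` (uniform truncation; size M–L): for admissible `ξ` and `ε > 0` there is `ρ₀`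
  such that for all `ρ ≥ ρ₀`, eventually in `N`, `|T_N(ξ) − T^ρ_N(ξ)| ≤ ε`. Content: the
  difference is at most the probability of an open path inside `H_N` from row `0` to a site with
  `|cos(π z/N)| ≥ ρ`, i.e. at height `Im z ≥ N · arccosh(ρ)/π` (`|cos(a+ib)| ≤ cosh b`); crossing
  `⌊arccosh(ρ)/π⌋` stacked `N × N` blocks of the width-`N` strip costs `(1 − c)^{⌊arccosh(ρ)/π⌋}` by
  RSW on `𝕋` (`tri_rsw_half_holds`, proved) and independence of disjoint blocks — uniformly in `N`.

Composition `HalfStripCardyZ2_of` (real proof, no `sorry`): stub 2 is turned back into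
`Tendsto` form (`Metric.tendsto_atTop`, `Real.dist_eq`); `u^ρᵢ → xᵢ` as `ρ → ∞`, the marks
`xᵢ` are strictly increasing (`cos` is strictly decreasing on `[0, π]`), so `crossRatio` is
continuous there and `η(ξ) ∈ (0,1)` (`crossRatio_mem_Ioo`), where `F` is continuous
(`continuousOn_cardyFunction_Ioo`); an `ε/3` argument over `ρ → ∞` then gives `T_N(ξ) → F(η(ξ))`,
and `Z_N = (Z_N − T_N) + T_N → 0 + F(η(ξ))` by the universality stub.

Device (as in `Cruxes/CardyRigidity/Lines/birth.lean`): stubs 2 and 3 are sorried theorems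
`Holds.stub_<name> : <full statement>` (registered under the short name `stub_<name>`) with the
by-name handles `def stub_<name> : Prop := type_of% Holds.stub_<name>`; stub 1 is the route item
`HalfStripUniversality` by name. The hypotheses of `HalfStripCardyZ2_of` are exactly these three,
by name, and its conclusion is the route decl `CardyPerronTeleport.HalfStripCardyZ2` BY NAME.

Negatives honoured: `ledger negatives --problem CriticalPhenomena` has one entry (SAW, stmt-0772),
unrelated; no `Disproof.lean` / Negative lemma exists for this crux (`ledger crux ls
stmt-CriticalPhenomena-5178`: no workfiles, 2026-08-17). No stub restates the crux or the summit:
stub 1 is a two-lattice DIFFERENCE statement, stubs 2–3 speak about site percolation on `𝕋` only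
(BC3 probes `stub → HalfStripCardyZ2`, `stub → CardyFormulaZ2` by `first | exact? | simpa |
simpa [defs] | aesop` fail 6/6, planner folder `bc/probe_stub{1,3}.lean`, `bc/probe_stub2_v2.lean`;
the `ε`–`N₀` typing of stub 2 is the one whose probes terminate — the equivalent `Tendsto` typing
sends `exact?` into a deterministic `whnf` timeout while it fails to unify the site-`𝕋` and
bond-`ℤ²` product measures, recorded in `bc/probe_stub2*.lean`).
-/

noncomputable section

namespace Summit.CriticalPhenomena.CardyFormulaZ2.Cruxes.HalfStripCardyZ2.Birth

open Filter Topology Set MeasureTheory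
open Literature.Probability.LatticeModels (Site zdGraph triGraph triSitePercolation triEmbed)
open Literature.Probability.Percolation (bondPercolation half openCrossing siteConnIn SiteConfig)
open Literature.Probability.RandomPlanarGeometry (cardyFunction crossRatio crossRatio_mem_Ioo
  continuousOn_cardyFunction_Ioo)
open Summit.CriticalPhenomena.CardyFormulaZ2.Theses.CardyPerronTeleport (HalfStripCardyZ2
  HalfStripUniversality)

/-! ### Vocabulary — abbreviations of the set-builder expressions of the route decls
(each unfolds definitionally to the text of `HalfStripCardyZ2` / `HalfStripUniversality`) -/

/-- The bottom arc `[⌊aN⌋, ⌊bN⌋] × {0}` of the discrete half-strip (lattice row `v₁ = 0`). -/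
def arc (a b : ℝ) (N : ℕ) : Set (Site 2) :=
  {v : Site 2 | v 1 = 0 ∧ ((⌊a * (N : ℝ)⌋₊ : ℕ) : ℤ) ≤ v 0 ∧ v 0 ≤ ((⌊b * (N : ℝ)⌋₊ : ℕ) : ℤ)}

/-- The discrete `ℤ²` half-strip `{0,…,N} × ℕ`. -/
def zHalfStrip (N : ℕ) : Set (Site 2) :=
  {v : Site 2 | 0 ≤ v 0 ∧ v 0 ≤ (N : ℤ) ∧ 0 ≤ v 1}

/-- The `𝕋` half-strip `{0 ≤ Re ≤ N, Im ≥ 0}` in lattice coordinates (`triEmbed v = v₀ + v₁ e^{iπ/3}`,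
so `Re = v₀ + v₁/2`, `Im = (√3/2) v₁`). -/
def triHalfStrip (N : ℕ) : Set (Site 2) :=
  {v : Site 2 | 0 ≤ v 1 ∧ 0 ≤ 2 * v 0 + v 1 ∧ 2 * v 0 + v 1 ≤ 2 * (N : ℤ)}

/-- The `ρ`-truncated `𝕋` half-strip `D_{ρ,N} = {v ∈ H_N : |cos(π · triEmbed v / N)| < ρ}`: the
lattice points of `N · D_ρ`, `D_ρ = {0 < Re z < 1, Im z > 0, |cos πz| < ρ}` (plus lattice points of
its bottom side and walls), the preimage of the half-disc of radius `ρ` under `w = −cos πz`. -/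
def triTrunc (ρ : ℝ) (N : ℕ) : Set (Site 2) :=
  {v : Site 2 | v ∈ triHalfStrip N ∧ ‖Complex.cos ((Real.pi : ℂ) * triEmbed v / (N : ℂ))‖ < ρ}

/-- `Z_N(ξ)`: the bond-`ℤ²` (`p = 1/2`) probability that the two bottom arcs are joined by an open
path of the `ℤ²` half-strip — the sequence of the crux `HalfStripCardyZ2`. -/
def bondArcProb (ξ : Fin 4 → ℝ) (N : ℕ) : ℝ :=
  (bondPercolation (zdGraph 2) half).real
    (openCrossing (zHalfStrip N) (arc (ξ 0) (ξ 1) N) (arc (ξ 2) (ξ 3) N))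

/-- `T_N^S(ξ)`: the site-`𝕋` (`p = 1/2`) probability that the two bottom arcs are joined by open
sites inside `S` (`S = triHalfStrip N`: the sequence of `HalfStripUniversality` / `HalfStripCardyT`;
`S = triTrunc ρ N`: its `ρ`-truncation). -/
def triArcProb (ξ : Fin 4 → ℝ) (S : Set (Site 2)) (N : ℕ) : ℝ :=
  (triSitePercolation half).real
    {ω : SiteConfig (Site 2) | ∃ x ∈ arc (ξ 0) (ξ 1) N, ∃ y ∈ arc (ξ 2) (ξ 3) N,
      ω ∈ siteConnIn triGraph S x y}

/-- The marks `xᵢ = −cos(π ξᵢ)` (images of the fractions `ξᵢ ∈ [0,1]` of the bottom side under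
`w = −cos πz`). -/
def marks (ξ : Fin 4 → ℝ) : Fin 4 → ℝ := fun i => - Real.cos (Real.pi * ξ i)

/-- The marks of the truncated domain `D_ρ` read in `ℍ`: `u^ρᵢ = xᵢ / (1 + (xᵢ/ρ)²)`, the boundary
values of `xᵢ` under the uniformiser `Φ_ρ = w / (1 + (w/ρ)²)` of `D_ρ` (`w = −cos πz`). -/
def truncMarks (ρ : ℝ) (ξ : Fin 4 → ℝ) : Fin 4 → ℝ := fun i => marks ξ i / (1 + (marks ξ i / ρ) ^ 2)

/-! ### The three registered stubs (the ONLY `sorry`s of this file) -/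

/-- **Stub 1 (OPEN; hardest) — half-strip end universality `site-𝕋 ↔ bond-ℤ²`**: the route item
`HalfStripUniversality` (stmt-CriticalPhenomena-5179) BY NAME — for admissible `ξ`,
`Z_N(ξ) − T_N(ξ) → 0`. Why it might fail: it is crossing universality on one quad family, open
(star–triangle transport never leaves the bond-isoradial class, arXiv:2502.08394 Rem. 5.6; the
intended corner-fugacity interpolation needs RSW without FKG). [cite: arXiv:1411.7020]
[cite: Beffara2008Universal] -/
theorem stub_halfStripUniversality : HalfStripUniversality := by
  sorry

/-- **Stub 2 (size L) — Smirnov's theorem on the truncated half-strips, explicit marks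
(`ε`–`N₀` form).** For admissible `ξ`, `ρ ≥ 2` and `ε > 0`, for all large `N` the site-`𝕋`
probability that the bottom arcs are joined inside `D_{ρ,N}` is within `ε` of
`F(crossRatio u^ρ(ξ))`, `u^ρᵢ = xᵢ/(1 + (xᵢ/ρ)²)` the marks of the Jordan domain `D_ρ` under its
uniformiser `Φ_ρ = w/(1 + (w/ρ)²)`, `w = −cos πz`. From Smirnov 2001 Thm 1, PROVED in the tree for
every bounded Jordan conformal rectangle (`hasCrossingLimit_triDomainCrossingProb_holds`), by: the
`ConformalRectangle` structure on `D_ρ` with this datum + G02-discretisation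
(`triDomainCrossingProb`) versus the explicit lattice sets (RSW boundary continuity at the four
marks). [cite: Smirnov2001, Thm 1] [cite: BollobasRiordan2006, Ch. 7 Thm 2] -/
protected theorem Holds.stub_truncatedCardyT : ∀ ξ : Fin 4 → ℝ, StrictMono ξ → 0 ≤ ξ 0 → ξ 3 ≤ 1 → ∀ ρ : ℝ, 2 ≤ ρ → ∀ ε : ℝ, 0 < ε → ∃ N₀ : ℕ, ∀ N : ℕ, N₀ ≤ N → |triArcProb ξ (triTrunc ρ N) N - cardyFunction (crossRatio (truncMarks ρ ξ))| < ε := by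
  sorry

/-- By-name handle of the registered stub `Holds.stub_truncatedCardyT`. -/
def stub_truncatedCardyT : Prop := type_of% Holds.stub_truncatedCardyT

/-- **Stub 3 (size M–L) — uniform RSW truncation of the `𝕋` half-strip.** For admissible `ξ` and
`ε > 0` there is `ρ₀` such that for every `ρ ≥ ρ₀`, eventually in `N`,
`|T_N(ξ) − T^ρ_N(ξ)| ≤ ε`: the difference is at most the probability of an open path of `H_N` from
row `0` to height `≥ N · arccosh(ρ)/π`, which crosses `⌊arccosh(ρ)/π⌋` stacked `N × N` blocks of the
width-`N` strip, each blocked by a closed wall-to-wall crossing of probability `≥ c` (RSW on `𝕋`,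
`tri_rsw_half_holds`; independence of disjoint blocks): `≤ (1 − c)^{⌊arccosh(ρ)/π⌋}` uniformly in
`N`. [cite: KestenPTM1982, §3.4] [cite: Werner2007, §3] -/
protected theorem Holds.stub_truncationRSW : ∀ ξ : Fin 4 → ℝ, StrictMono ξ → 0 ≤ ξ 0 → ξ 3 ≤ 1 → ∀ ε : ℝ, 0 < ε → ∃ ρ₀ : ℝ, ∀ ρ : ℝ, ρ₀ ≤ ρ → ∀ᶠ N : ℕ in Filter.atTop, |triArcProb ξ (triHalfStrip N) N - triArcProb ξ (triTrunc ρ N) N| ≤ ε := by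
  sorry

/-- By-name handle of the registered stub `Holds.stub_truncationRSW`. -/
def stub_truncationRSW : Prop := type_of% Holds.stub_truncationRSW

/-! ### Glue lemmas (sorry-free) -/

/-- The marks `xᵢ = −cos(π ξᵢ)` of admissible fractions are strictly increasing (`cos` is
strictly decreasing on `[0, π]`). -/
theorem strictMono_marks {ξ : Fin 4 → ℝ} (hξ : StrictMono ξ) (h0 : 0 ≤ ξ 0) (h3 : ξ 3 ≤ 1) :
    StrictMono (marks ξ) := by
  intro i j hij
  have hi0 : 0 ≤ ξ i := le_trans h0 (hξ.monotone (Fin.zero_le _))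
  have hj3 : ξ j ≤ ξ 3 := hξ.monotone (Fin.le_last j)
  have hj1 : ξ j ≤ 1 := le_trans hj3 h3
  have hlt : ξ i < ξ j := hξ hij
  have hπ := Real.pi_pos
  have hcos : Real.cos (Real.pi * ξ j) < Real.cos (Real.pi * ξ i) :=
    Real.cos_lt_cos_of_nonneg_of_le_pi (by positivity) (by nlinarith) (by nlinarith)
  show - Real.cos (Real.pi * ξ i) < - Real.cos (Real.pi * ξ j)
  linarith

/-- `u^ρᵢ → xᵢ` as `ρ → ∞`. -/
theorem tendsto_truncMarks (ξ : Fin 4 → ℝ) (i : Fin 4) :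
    Tendsto (fun ρ : ℝ => truncMarks ρ ξ i) atTop (𝓝 (marks ξ i)) := by
  have h1 : Tendsto (fun ρ : ℝ => marks ξ i / ρ) atTop (𝓝 0) :=
    tendsto_const_nhds.div_atTop tendsto_id
  have h2 : Tendsto (fun ρ : ℝ => 1 + (marks ξ i / ρ) ^ 2) atTop (𝓝 1) := by
    have := tendsto_const_nhds (x := (1 : ℝ)) (f := (atTop : Filter ℝ)) |>.add (h1.pow 2)
    simpa using this
  have h3 : Tendsto (fun ρ : ℝ => marks ξ i / (1 + (marks ξ i / ρ) ^ 2)) atTop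
      (𝓝 (marks ξ i / 1)) :=
    tendsto_const_nhds.div h2 one_ne_zero
  simpa [truncMarks] using h3

/-- The cross-ratio of the truncated marks tends to `η(ξ)` (continuity of the rational function
`crossRatio` at a tuple with non-vanishing denominators). -/
theorem tendsto_crossRatio_truncMarks {ξ : Fin 4 → ℝ} (hx : StrictMono (marks ξ)) :
    Tendsto (fun ρ : ℝ => crossRatio (truncMarks ρ ξ)) atTop (𝓝 (crossRatio (marks ξ))) := by
  have h := tendsto_truncMarks ξ
  have hden : (marks ξ 0 - marks ξ 2) * (marks ξ 1 - marks ξ 3) ≠ 0 := by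
    have a := hx (show (0 : Fin 4) < 2 by decide)
    have b := hx (show (1 : Fin 4) < 3 by decide)
    exact mul_ne_zero (sub_ne_zero.2 a.ne) (sub_ne_zero.2 b.ne)
  have hlim := (((h 0).sub (h 1)).mul ((h 2).sub (h 3))).div
    (((h 0).sub (h 2)).mul ((h 1).sub (h 3))) hden
  simpa only [crossRatio, Pi.div_def] using hlim

/-- `F(crossRatio u^ρ(ξ)) → F(η(ξ))` as `ρ → ∞`: `η(ξ) ∈ (0,1)` (`crossRatio_mem_Ioo`) where `F` is
continuous (`continuousOn_cardyFunction_Ioo`). -/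
theorem tendsto_cardy_truncMarks {ξ : Fin 4 → ℝ} (hξ : StrictMono ξ) (h0 : 0 ≤ ξ 0) (h3 : ξ 3 ≤ 1) :
    Tendsto (fun ρ : ℝ => cardyFunction (crossRatio (truncMarks ρ ξ))) atTop
      (𝓝 (cardyFunction (crossRatio (marks ξ)))) := by
  have hx := strictMono_marks hξ h0 h3
  have hη : crossRatio (marks ξ) ∈ Set.Ioo (0 : ℝ) 1 := crossRatio_mem_Ioo (Or.inl hx)
  have hcont : ContinuousAt cardyFunction (crossRatio (marks ξ)) :=
    continuousOn_cardyFunction_Ioo.continuousAt (Ioo_mem_nhds hη.1 hη.2)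
  exact hcont.tendsto.comp (tendsto_crossRatio_truncMarks hx)

/-- **The `𝕋` half-strip end law is Cardy's** (the conclusion of the route's support
`HalfStripCardyT`, here derived from stubs 2–3 unconditionally fed): `T_N(ξ) → F(η(ξ))`, by an
`ε/3` argument — choose `ρ` large for the truncation (stub 3) and for `|F(η_ρ) − F(η)|` (continuity),
then `N` large for stub 2 at that `ρ`. -/
theorem tendsto_triArcProb_halfStrip
    (hT : ∀ ρ : ℝ, 2 ≤ ρ → ∀ ξ : Fin 4 → ℝ, StrictMono ξ → 0 ≤ ξ 0 → ξ 3 ≤ 1 →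
      Tendsto (fun N : ℕ => triArcProb ξ (triTrunc ρ N) N) atTop
        (𝓝 (cardyFunction (crossRatio (truncMarks ρ ξ)))))
    (hR : ∀ ξ : Fin 4 → ℝ, StrictMono ξ → 0 ≤ ξ 0 → ξ 3 ≤ 1 → ∀ ε : ℝ, 0 < ε → ∃ ρ₀ : ℝ,
      ∀ ρ : ℝ, ρ₀ ≤ ρ → ∀ᶠ N : ℕ in atTop,
        |triArcProb ξ (triHalfStrip N) N - triArcProb ξ (triTrunc ρ N) N| ≤ ε)
    {ξ : Fin 4 → ℝ} (hξ : StrictMono ξ) (h0 : 0 ≤ ξ 0) (h3 : ξ 3 ≤ 1) :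
    Tendsto (fun N : ℕ => triArcProb ξ (triHalfStrip N) N) atTop
      (𝓝 (cardyFunction (crossRatio (marks ξ)))) := by
  set L : ℝ := cardyFunction (crossRatio (marks ξ)) with hL
  have hF := tendsto_cardy_truncMarks hξ h0 h3
  rw [Metric.tendsto_atTop]
  intro ε hε
  have hε3 : 0 < ε / 3 := by positivity
  obtain ⟨ρ₁, hρ₁⟩ := hR ξ hξ h0 h3 (ε / 3) hε3
  obtain ⟨ρ₂, hρ₂⟩ := Filter.eventually_atTop.1 ((Metric.tendsto_nhds.1 hF) (ε / 3) hε3)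
  set ρ : ℝ := max (max ρ₁ ρ₂) 2 with hρ
  have hρ1 : ρ₁ ≤ ρ := le_trans (le_max_left _ _) (le_max_left _ _)
  have hρ2 : ρ₂ ≤ ρ := le_trans (le_max_right _ _) (le_max_left _ _)
  have hρ2' : (2 : ℝ) ≤ ρ := le_max_right _ _
  have hA : ∀ᶠ N : ℕ in atTop,
      |triArcProb ξ (triHalfStrip N) N - triArcProb ξ (triTrunc ρ N) N| ≤ ε / 3 := hρ₁ ρ hρ1
  have hB : ∀ᶠ N : ℕ in atTop,
      dist (triArcProb ξ (triTrunc ρ N) N) (cardyFunction (crossRatio (truncMarks ρ ξ))) < ε / 3 :=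
    (Metric.tendsto_nhds.1 (hT ρ hρ2' ξ hξ h0 h3)) (ε / 3) hε3
  have hC : dist (cardyFunction (crossRatio (truncMarks ρ ξ))) L < ε / 3 := hρ₂ ρ hρ2
  obtain ⟨N₀, hN₀⟩ := Filter.eventually_atTop.1 (hA.and hB)
  refine ⟨N₀, fun N hN => ?_⟩
  obtain ⟨hA', hB'⟩ := hN₀ N hN
  rw [Real.dist_eq] at hB' hC ⊢
  have hsplit : triArcProb ξ (triHalfStrip N) N - L =
      (triArcProb ξ (triHalfStrip N) N - triArcProb ξ (triTrunc ρ N) N)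
        + (triArcProb ξ (triTrunc ρ N) N - cardyFunction (crossRatio (truncMarks ρ ξ)))
        + (cardyFunction (crossRatio (truncMarks ρ ξ)) - L) := by ring
  calc |triArcProb ξ (triHalfStrip N) N - L|
      = |(triArcProb ξ (triHalfStrip N) N - triArcProb ξ (triTrunc ρ N) N)
        + (triArcProb ξ (triTrunc ρ N) N - cardyFunction (crossRatio (truncMarks ρ ξ)))
        + (cardyFunction (crossRatio (truncMarks ρ ξ)) - L)| := by rw [hsplit]
    _ ≤ |triArcProb ξ (triHalfStrip N) N - triArcProb ξ (triTrunc ρ N) N|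
        + |triArcProb ξ (triTrunc ρ N) N - cardyFunction (crossRatio (truncMarks ρ ξ))|
        + |cardyFunction (crossRatio (truncMarks ρ ξ)) - L| := abs_add_three _ _ _
    _ < ε := by linarith

/-! ### The composition (sorry-free): the three stubs imply the crux BY NAME -/

/-- **`HalfStripCardyZ2` from the three stubs.** Stub 2 (read back in `Tendsto` form through
`Metric.tendsto_atTop`) and stub 3 give the `𝕋` half-strip end law `T_N(ξ) → F(η(ξ))`
(`tendsto_triArcProb_halfStrip`); stub 1 (universality) gives `Z_N − T_N → 0`; hence
`Z_N = (Z_N − T_N) + T_N → F(η(ξ))`, which is the crux `CardyPerronTeleport.HalfStripCardyZ2`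
(the vocabulary unfolds to its text definitionally). -/
theorem HalfStripCardyZ2_of (hU : HalfStripUniversality) (hT : stub_truncatedCardyT)
    (hR : stub_truncationRSW) : HalfStripCardyZ2 := by
  dsimp only [stub_truncatedCardyT, stub_truncationRSW] at hT hR
  intro ξ hξ h0 h3
  have hT' : ∀ ρ : ℝ, 2 ≤ ρ → ∀ ξ : Fin 4 → ℝ, StrictMono ξ → 0 ≤ ξ 0 → ξ 3 ≤ 1 →
      Tendsto (fun N : ℕ => triArcProb ξ (triTrunc ρ N) N) atTop
        (𝓝 (cardyFunction (crossRatio (truncMarks ρ ξ)))) := by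
    intro ρ hρ ξ' hξ' h0' h3'
    rw [Metric.tendsto_atTop]
    intro ε hε
    obtain ⟨N₀, hN₀⟩ := hT ξ' hξ' h0' h3' ρ hρ ε hε
    exact ⟨N₀, fun N hN => by rw [Real.dist_eq]; exact hN₀ N hN⟩
  have hlimT : Tendsto (fun N : ℕ => triArcProb ξ (triHalfStrip N) N) atTop
      (𝓝 (cardyFunction (crossRatio (marks ξ)))) :=
    tendsto_triArcProb_halfStrip hT' hR hξ h0 h3
  have hdiff : Tendsto (fun N : ℕ => bondArcProb ξ N - triArcProb ξ (triHalfStrip N) N) atTop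
      (𝓝 0) :=
    hU ξ hξ h0 h3
  have hsum := hdiff.add hlimT
  simp only [sub_add_cancel, zero_add] at hsum
  exact hsum

/-- **The crux BY NAME from the three stubs** — depends on `sorryAx` ONLY through
`stub_halfStripUniversality`, `Holds.stub_truncatedCardyT`, `Holds.stub_truncationRSW`; this line
also certifies mechanically that the two handles ARE the stub statements. -/
theorem HalfStripCardyZ2_proof : HalfStripCardyZ2 :=
  HalfStripCardyZ2_of stub_halfStripUniversality Holds.stub_truncatedCardyT Holds.stub_truncationRSW

end Summit.CriticalPhenomena.CardyFormulaZ2.Cruxes.HalfStripCardyZ2.Birth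

end
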